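import Mathlib
import HarnessLib
import Summits.ResolutionOfSingularities.ResolutionOfSingularities.Theorems.WildQuotientsWildQuotientResolutionStubQuotientModel
import Summits.ResolutionOfSingularities.ResolutionOfSingularities.Theorems.WildQuotientsWildQuotientResolutionStubBirational
import Literature.AlgebraicGeometry.Resolution.ComponentGluing

/-!
# The quotient model `V/G → X₁` is integral, proper and birational (no regularity)

Crux stmt-ResolutionOfSingularities-15640 (`WildQuotients.WildQuotientResolution`), line `Sketch`,
sector of equivariant models; CHAIN w45c v4 §4, lead-1 (iii) / LIN-hBR stub **Q1**
`quotientModel_proper_birational`. [OURS · L1 W4.5c] — the non-regularity half of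
`CyclicTransfer.cyclicDivisorialTransfer` (p459590) factored out, for ANY finite group `G`
(no `|G| = p`, no characteristic hypothesis); NOT a statement of the manuscript.

For the crux data `(X′, X₁, q, G, ρ)` (`q : X′ → X₁` finite, surjective, generically étale, with the
`G`-orbits as fibres, `ρ` faithful, `dim X₁ > 0`) and a `G`-equivariant proper birational integral
model `π : V → X′` whose action `ρB` over `X₁` admits a cover by `G`-stable opens affine over `X₁`,
the glued quotient `Y₁ := V/G` (`ActionOver.glued`) is integral and the descended morphism
`g : V/G → X₁` (`ActionOver.gluedDesc`) is proper and birational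
(`quotientModel_proper_birational`). Hence any resolution of `V/G` — e.g. from REGULARITY of the
chart rings (K–L terminal state, p459590) or from tame/graded étale charts (T2, p465412) — gives a
resolution of `X₁` (`hasResolution_of_hasResolution_glued`). `stableAffineOpens_cover_of_cover`
converts the chain's usual cover hypothesis (`G`-stable affine opens of `V`) into the
`StableAffineOpens` cover of the gluing.
-/

-- single-problem summit: the doubled namespace component `ResolutionOfSingularities` is forced
set_option linter.dupNamespace false

noncomputable section

open CategoryTheory Limits AlgebraicGeometry TopologicalSpace
open Literature.AlgebraicGeometry.Resolution Literature.AlgebraicGeometry.RelativeSpec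

namespace Summit.ResolutionOfSingularities.ResolutionOfSingularities.Theorems.WildQuotientResolution.QuotientModel

/-- **A `G`-stable affine cover is a cover by stable opens affine over the base** when the base
is separated: an affine open `W ⊆ V` maps to the separated `X₁` by an affine morphism.
[folklore] -/
theorem stableAffineOpens_cover_of_cover {V X₁ : Scheme.{0}} {r : V ⟶ X₁} {G : Type} [Group G]
    (ρB : ActionOver r G) [X₁.IsSeparated]
    (hcov : ∀ v : V, ∃ W : V.Opens, IsAffineOpen W ∧ v ∈ W ∧ ∀ g : G, (ρB.aut g).hom ⁻¹ᵁ W = W) :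
    ∀ v : V, ∃ O : ρB.StableAffineOpens, v ∈ O.1 := by
  intro v
  obtain ⟨W, hW, hvW, hWst⟩ := hcov v
  haveI : IsAffine W := hW
  exact ⟨⟨W, hWst, isAffineHom_of_isAffine_of_isSeparated _⟩, hvW⟩

/-- **Q1: the quotient model is integral, proper and birational.** For the crux data
`(X′, X₁, q, G, ρ)` with `ρ` faithful, `q` finite surjective with orbit fibres and étale over a
dense open, `dim X₁ > 0`, and a `G`-equivariant proper birational integral model `π : V → X′`
with action `ρB` over the separated `X₁` covered by `G`-stable opens affine over `X₁`: the glued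
quotient `V/G` is integral, and `V/G → X₁` is proper (`ActionOver.isProper_gluedDesc`) and birational (it is
finite, étale and bijective over a dense open by the `W`-clause
`QuotientModel.exists_dense_isFinite_etale_bijective`, the action on `V` being faithful because
`π` is dominant onto the separated reduced `X′`; then lemma (L)
`Birational.stub_birational_of_bijective`). No regularity and no hypothesis on `|G|` or the
characteristic. [cite: SGA1, Exp. V, Prop. 2.6] [cite: MumfordAV1970, §7 Thm. p. 66] -/
theorem quotientModel_proper_birational (k : Type) [Field k]
    (X' X₁ : Scheme.{0}) (f : X₁ ⟶ Spec (.of k)) (q : X' ⟶ X₁) (G : Type) [Group G] [Finite G]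
    (ρ : G →* Aut X') (hfaith : Function.Injective ρ)
    [X₁.IsSeparated] [LocallyOfFiniteType f] [IsIntegral X₁] [IsIntegral X']
    [IsFinite q] (hdim : ¬ topologicalKrullDim X₁ ≤ 0) (hsurj : Function.Surjective q.base)
    (hU : ∃ U : X₁.Opens, Dense (U : Set X₁) ∧ Etale (q ∣_ U))
    (horb : ∀ x y : X', q.base x = q.base y → ∃ g : G, (ρ g).hom.base x = y)
    (V : Scheme.{0}) (π : V ⟶ X') [IsProper π] (hbir : IsBirational π) [IsIntegral V]
    (ρB : ActionOver (π ≫ q) G)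
    (hequiv : ∀ g : G, (ρB.aut g).hom ≫ π = π ≫ (ρ g).hom)
    (hcov : ∀ v : V, ∃ O : ρB.StableAffineOpens, v ∈ O.1) :
    IsIntegral ρB.glued ∧ IsProper (ρB.gluedDesc (π ≫ q) ρB.aut_comp) ∧
      IsBirational (ρB.gluedDesc (π ≫ q) ρB.aut_comp) := by
  classical
  -- separatedness upstairs and noetherianity downstairs
  haveI : X'.IsSeparated := ⟨by rw [← terminal.comp_from q]; infer_instance⟩
  haveI : IsLocallyNoetherian X₁ := LocallyOfFiniteType.isLocallyNoetherian f
  -- the action on `V` is faithful: `π` is dominant onto the reduced separated `X′`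
  haveI : IsDominant π := hbir.isDominant
  have hinj : Function.Injective ρB.aut := by
    intro g₁ g₂ h
    rw [← inv_mul_eq_one]
    apply hfaith
    rw [map_one]
    have h1 : ρB.aut (g₁⁻¹ * g₂) = 1 := by
      rw [map_mul, map_inv, inv_mul_eq_one]
      exact h
    have h2 : π ≫ (ρ (g₁⁻¹ * g₂)).hom = π ≫ 𝟙 X' := by
      rw [Category.comp_id, ← hequiv, h1]
      exact Category.id_comp π
    have h3 : (ρ (g₁⁻¹ * g₂)).hom = 𝟙 X' := ext_of_isDominant π h2
    ext : 1
    exact h3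
  -- `V/G` is integral, `V/G → X₁` proper
  haveI hY₁ : IsIntegral ρB.glued := ρB.isIntegral_glued hcov
  haveI hr : IsProper (ρB.gluedDesc (π ≫ q) ρB.aut_comp) :=
    ρB.isProper_gluedDesc hcov (π ≫ q) ρB.aut_comp (𝟙 X₁) (Category.comp_id _)
  -- and birational, by the `W`-clause and lemma (L)
  obtain ⟨W, hWd, hWfin, hWet, hWbij⟩ :=
    QuotientModel.exists_dense_isFinite_etale_bijective π q ρB hcov hinj ρ hequiv horb hsurj hU
      hbir
  haveI := hWfin
  haveI := hWet
  have hrbir : IsBirational (ρB.gluedDesc (π ≫ q) ρB.aut_comp) :=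
    Birational.stub_birational_of_bijective k f (ρB.gluedDesc (π ≫ q) ρB.aut_comp) hdim W hWd
      hWbij
  exact ⟨hY₁, hr, hrbir⟩

/-- **Transfer along the quotient model**: under the hypotheses of
`quotientModel_proper_birational`, a resolution of the glued quotient `V/G` gives a resolution
of `X₁` (resolutions transfer along proper birational morphisms,
`ComponentGluing.Scheme.HasResolution.of_isBirational`). This is the common last step of the
K–L lane (p459590: `V/G` regular) and of the tame/graded-chart lane (T2, p465412).
[OURS · L1 W4.5c, helper] [folklore] -/
theorem hasResolution_of_hasResolution_glued (k : Type) [Field k]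
    (X' X₁ : Scheme.{0}) (f : X₁ ⟶ Spec (.of k)) (q : X' ⟶ X₁) (G : Type) [Group G] [Finite G]
    (ρ : G →* Aut X') (hfaith : Function.Injective ρ)
    [X₁.IsSeparated] [LocallyOfFiniteType f] [IsIntegral X₁] [IsIntegral X']
    [IsFinite q] (hdim : ¬ topologicalKrullDim X₁ ≤ 0) (hsurj : Function.Surjective q.base)
    (hU : ∃ U : X₁.Opens, Dense (U : Set X₁) ∧ Etale (q ∣_ U))
    (horb : ∀ x y : X', q.base x = q.base y → ∃ g : G, (ρ g).hom.base x = y)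
    (V : Scheme.{0}) (π : V ⟶ X') [IsProper π] (hbir : IsBirational π) [IsIntegral V]
    (ρB : ActionOver (π ≫ q) G)
    (hequiv : ∀ g : G, (ρB.aut g).hom ≫ π = π ≫ (ρ g).hom)
    (hcov : ∀ v : V, ∃ O : ρB.StableAffineOpens, v ∈ O.1)
    (hres : Scheme.HasResolution ρB.glued) :
    Scheme.HasResolution X₁ := by
  obtain ⟨_, hr, hrbir⟩ := quotientModel_proper_birational k X' X₁ f q G ρ hfaith hdim hsurj hU
    horb V π hbir ρB hequiv hcov
  exact ComponentGluing.Scheme.HasResolution.of_isBirational (ρB.gluedDesc (π ≫ q) ρB.aut_comp)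
    hrbir hres

end Summit.ResolutionOfSingularities.ResolutionOfSingularities.Theorems.WildQuotientResolution.QuotientModel

end
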